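import Mathlib.Analysis.Analytic.Order
import Mathlib.Analysis.Analytic.Polynomial
import Mathlib.Analysis.Calculus.IteratedDeriv.Lemmas
import Mathlib.Analysis.Calculus.Deriv.Polynomial
import Mathlib.Analysis.Complex.Basic
import Mathlib.Algebra.Polynomial.Derivative
import Mathlib.Algebra.Polynomial.BigOperators
import Mathlib.RingTheory.PowerSeries.Trunc
import HarnessLib

/-!
# Auxiliary lemmas for the analytic Puiseux branches

Topic `Literature/FieldTheory/AlgClosed` (support for `PuiseuxAnalyticBranches.lean`):

* simple roots of a product `c · ∏_{v ∈ S} (X − v)` over a domain (`eval_derivative_prod_ne_zero`);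
* a common index below which finitely many distinct power series already differ
  (`exists_index_coeff_ne`);
* Taylor coefficients at `0` of `s ↦ T(s) + sᴺ ρ(s)`: those of the polynomial `T` in degrees `< N`
  (`iteratedDeriv_polynomial_eval_zero`, `iteratedDeriv_pow_mul_eq_zero`);
* evaluation at `s = 0` commutes with an embedding `K → ℂ` (`eval_map_eval₂RingHom_zero`).

All elementary; [folklore].

## References

* J. Kollár, *Lectures on Resolution of Singularities* (2007), 1.94–1.95. [Kollar2007]
-/

noncomputable section

namespace Literature.FieldTheory.AlgClosed

open Polynomial Filter Topology
open scoped PowerSeries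

/-! ### Simple roots of a product of distinct linear factors over a domain -/

/-- `c · ∏_{w ∈ S} (X − w)` vanishes at every `v ∈ S`. [folklore] -/
theorem eval_C_mul_prod_X_sub_C_eq_zero {R : Type*} [CommRing R] (c : R) (S : Finset R) {v : R}
    (hv : v ∈ S) : (Polynomial.C c * ∏ w ∈ S, (Polynomial.X - Polynomial.C w)).eval v = 0 := by
  rw [Polynomial.eval_mul, Polynomial.eval_prod, Finset.prod_eq_zero hv (by simp), mul_zero]

/-- Over a domain, every `v ∈ S` is a SIMPLE root of `c · ∏_{w ∈ S} (X − w)` (`c ≠ 0`):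
the derivative there is `c · ∏_{w ≠ v} (v − w) ≠ 0`. [folklore] -/
theorem eval_derivative_prod_ne_zero {R : Type*} [CommRing R] [IsDomain R] {c : R} (hc : c ≠ 0)
    (S : Finset R) {v : R} (hv : v ∈ S) :
    (Polynomial.derivative (Polynomial.C c * ∏ w ∈ S, (Polynomial.X - Polynomial.C w))).eval v ≠ 0 := by
  classical
  rw [Polynomial.derivative_mul, Polynomial.derivative_C, zero_mul, zero_add, Polynomial.eval_mul,
    Polynomial.eval_C, Polynomial.derivative_prod_finset, Polynomial.eval_finsetSum,
    Finset.sum_eq_single_of_mem v hv]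
  · rw [Polynomial.eval_mul, Polynomial.derivative_sub, Polynomial.derivative_X,
      Polynomial.derivative_C, sub_zero, Polynomial.eval_one, mul_one, Polynomial.eval_prod]
    refine mul_ne_zero hc (Finset.prod_ne_zero_iff.mpr fun w hw => ?_)
    rw [Polynomial.eval_sub, Polynomial.eval_X, Polynomial.eval_C, sub_ne_zero]
    exact fun h => (Finset.mem_erase.mp hw).1 h.symm
  · intro w hw hwv
    rw [Polynomial.eval_mul, Polynomial.eval_prod,
      Finset.prod_eq_zero (Finset.mem_erase.mpr ⟨Ne.symm hwv, hv⟩) (by simp), zero_mul]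

/-! ### A common distinguishing index for finitely many power series -/

/-- Finitely many pairwise distinct power series already differ below a common index `N₁`:
for all `v ≠ v'` in `S` some coefficient of index `< N₁` differs. [folklore] -/
theorem exists_index_coeff_ne {K : Type*} [Field K] (S : Finset K⟦X⟧) :
    ∃ N₁ : ℕ, ∀ v ∈ S, ∀ v' ∈ S, v ≠ v' → ∃ i, i < N₁ ∧ PowerSeries.coeff i v ≠ PowerSeries.coeff i v' := by
  classical
  have hex : ∀ p : K⟦X⟧ × K⟦X⟧, ∃ i : ℕ, p.1 ≠ p.2 → PowerSeries.coeff i p.1 ≠ PowerSeries.coeff i p.2 := by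
    rintro ⟨v, v'⟩
    by_cases h : v = v'
    · exact ⟨0, fun hne => absurd h hne⟩
    · obtain ⟨i, hi⟩ : ∃ i, PowerSeries.coeff i v ≠ PowerSeries.coeff i v' := by
        by_contra hcon
        exact h (PowerSeries.ext fun n => not_not.mp fun hne => hcon ⟨n, hne⟩)
      exact ⟨i, fun _ => hi⟩
  choose idx hidx using hex
  refine ⟨(S ×ˢ S).sup idx + 1, fun v hv v' hv' hne => ⟨idx (v, v'), ?_, hidx (v, v') hne⟩⟩
  have : idx (v, v') ≤ (S ×ˢ S).sup idx := Finset.le_sup (f := idx) (Finset.mem_product.mpr ⟨hv, hv'⟩)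
  omega

/-- Truncations of order `≥ i + 1` keep the coefficient of index `i`. [folklore] -/
theorem coeff_trunc_of_lt {K : Type*} [Field K] {i N : ℕ} (h : i < N) (v : K⟦X⟧) :
    (PowerSeries.trunc N v).coeff i = PowerSeries.coeff i v := by
  rw [PowerSeries.coeff_trunc, if_pos h]

/-! ### Taylor coefficients at `0` of `T(s) + sᴺ ρ(s)` -/

/-- Iterated derivatives of a polynomial function are the evaluations of the iterated formal
derivatives. [folklore] -/
theorem iteratedDeriv_polynomial_eval (p : ℂ[X]) (k : ℕ) :
    iteratedDeriv k (fun s : ℂ => p.eval s) = fun s => (Polynomial.derivative^[k] p).eval s := by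
  induction k with
  | zero => simp
  | succ k ih =>
    rw [iteratedDeriv_succ, ih, Function.iterate_succ_apply']
    funext s
    exact Polynomial.deriv _

/-- The `k`-th derivative at `0` of a polynomial function is `k! ·` its `k`-th coefficient.
[folklore] -/
theorem iteratedDeriv_polynomial_eval_zero (p : ℂ[X]) (k : ℕ) :
    iteratedDeriv k (fun s : ℂ => p.eval s) 0 = (k.factorial : ℂ) * p.coeff k := by
  rw [iteratedDeriv_polynomial_eval]
  change (Polynomial.derivative^[k] p).eval 0 = _
  rw [← Polynomial.coeff_zero_eq_eval_zero, Polynomial.coeff_iterate_derivative, zero_add,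
    Nat.descFactorial_self, nsmul_eq_mul]

/-- `s ↦ sᴺ ρ(s)` (with `ρ` analytic at `0`) has vanishing derivatives of order `< N` at `0`.
[folklore] -/
theorem iteratedDeriv_pow_mul_eq_zero {ρ : ℂ → ℂ} (hρ : AnalyticAt ℂ ρ 0) {N i : ℕ} (hi : i < N) :
    iteratedDeriv i (fun s : ℂ => s ^ N * ρ s) 0 = 0 := by
  have hpow : AnalyticAt ℂ (fun s : ℂ => s ^ N) 0 := analyticAt_id.pow N
  have hord : (N : ℕ∞) ≤ analyticOrderAt (fun s : ℂ => s ^ N * ρ s) 0 := by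
    have hN : analyticOrderAt (fun s : ℂ => s ^ N) 0 = N := by
      rw [hpow.analyticOrderAt_eq_natCast]
      exact ⟨fun _ => 1, analyticAt_const, one_ne_zero, Filter.Eventually.of_forall fun z => by simp⟩
    have hmul : analyticOrderAt (fun s : ℂ => s ^ N * ρ s) 0 =
        analyticOrderAt (fun s : ℂ => s ^ N) 0 + analyticOrderAt ρ 0 := analyticOrderAt_mul hpow hρ
    rw [hmul, hN]
    exact le_self_add
  exact (natCast_le_analyticOrderAt_iff_iteratedDeriv_eq_zero (hpow.mul hρ)).1 hord i hi

/-- Taylor coefficients of a shifted branch `s ↦ T(s) + sᴺ ρ(s)` below order `N` are those of the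
polynomial `T`: `Y⁽ⁱ⁾(0) = i! · Tᵢ` for `i < N`. [cite: Kollar2007, 1.95] -/
theorem iteratedDeriv_shiftedBranch_zero {ρ : ℂ → ℂ} (hρ : AnalyticAt ℂ ρ 0) (T : ℂ[X])
    {N i : ℕ} (hi : i < N) :
    iteratedDeriv i (fun s : ℂ => T.eval s + s ^ N * ρ s) 0 = (i.factorial : ℂ) * T.coeff i := by
  have h1 : ContDiffAt ℂ i (fun s : ℂ => T.eval s) 0 :=
    ((AnalyticOnNhd.eval_polynomial T) 0 (Set.mem_univ _)).contDiffAt.of_le le_top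
  have h2 : ContDiffAt ℂ i (fun s : ℂ => s ^ N * ρ s) 0 :=
    ((analyticAt_id.pow N).mul hρ).contDiffAt.of_le le_top
  have hadd := iteratedDeriv_add h1 h2
  change iteratedDeriv i ((fun s : ℂ => T.eval s) + fun s : ℂ => s ^ N * ρ s) 0 = _ at hadd ⊢
  rw [hadd, iteratedDeriv_polynomial_eval_zero, iteratedDeriv_pow_mul_eq_zero hρ hi, add_zero]

/-! ### Evaluation at `s = 0` and an embedding `K → ℂ` -/

/-- Evaluating `G ∈ K[s][Y]` at `s = 0` and then embedding into `ℂ` is complex evaluation at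
`(0, u)`. [folklore] -/
theorem eval_map_eval₂RingHom_zero {K : Type*} [Field K] [Algebra K ℂ] (G : K[X][X]) (u : K) :
    (G.map (Polynomial.eval₂RingHom (algebraMap K ℂ) 0)).eval (algebraMap K ℂ u) =
      algebraMap K ℂ ((G.map (Polynomial.evalRingHom 0)).eval u) := by
  have hhom : (algebraMap K ℂ).comp (Polynomial.evalRingHom (0 : K)) =
      Polynomial.eval₂RingHom (algebraMap K ℂ) 0 := by
    refine Polynomial.ringHom_ext (fun a => ?_) ?_
    · simp
    · simp
  rw [Polynomial.eval_map, Polynomial.eval_map, Polynomial.hom_eval₂, hhom]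

end Literature.FieldTheory.AlgClosed

end
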